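import Mathlib
import Summits.PneNP.PneNP.Theorems.ConvexRankGatesConvexGateBlindSoftWindow
import Summits.PneNP.PneNP.Theorems.ConvexRankGatesConvexGateBlindAffinePencilMoment
import Summits.PneNP.PneNP.Theorems.ConvexRankGatesConvexGateBlindAffinePencilNorm

/-!
# PneNP / ConvexRankGates — `ConvexGateBlind`: the six-dimensional exclusion construction — data and bookkeeping

Helpers (`--supports stmt-PneNP-10680`), COLUMN-SPACE line (prover seat 2, session 26), PSD side. PROPOSITION L of memo
ANALYSIS-seat2-s26 §2.3: for a `(k−2)`-set `S` ONE valid `6 × 6` affine pencil — one second-order-cone constraint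
`u ↦ (a(u); b(u)) ∈ ℝ × ℝ⁵` — excludes every `k`-set `S ∪ {x, y}`. This file fixes the DATA of that construction and its
bookkeeping (bounds in `…AffinePencilSixBounds.lean`); validity is `…AffinePencilSixValid.lean`, exclusion and the count `c(6; m,k) ≥ C(m−k+2, 2)` are
`…AffinePencilSix.lean`.

All names live in the sub-namespace `SixPencil`. Edges of `K_m` fall in three classes by `cls S e = #(e ∩ S)`: CORE (`2`), SPOKE (`1`), RIM (`0`). Vertex `v` sits at the
point `U v = (1, v, v², v³, v⁴)` of the moment curve; a rim `e = {x,y}` gets the unit QUARTIC NORMAL `nvec e` of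
`1 − (t−x)²(t−y)²` (`edgeN_eq_quarticVec`, `nvec_unit`), which sees `U x`, `U y` at height `η_e > 0` and every other `U v`
at height `≤ 0`. Adding an edge to the graph adds to `(a; b)`:
    core `(−B ; 0)`,   spoke `{s, v}` `(0 ; U v/(k−2))`,   rim `e` `(L + c_e ; L·nvec e)`,   `c_e = κ η_e − A`,
from the base point `(A + #core·B ; 0)` (`κ = 2 − 1/(2(k−2))`; `A, B, L` explicit, `abud`, `bvec`). Bookkeeping proved here:
`abud_eq` / `bvec_eq` (the SOC data of a graph in terms of its core count, its spoke vector `wvec` and its rim set),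
`η_e ∈ (0,1]`, the two evaluations of a rim normal on the moment curve, and `nvec_injective`; the numerical bounds are in
`…AffinePencilSixBounds.lean`. [new]
-/

set_option linter.dupNamespace false

namespace Summit.PneNP.PneNP.Theorems

open Finset Real Matrix Literature.Computability.Complexity
open Summit.PneNP.PneNP.Cruxes.ConvexGateBlind.StrictRankConicCover (Edge cdist)

noncomputable section

namespace SixPencil

variable {m : ℕ}

/-! ## Vertices on the moment curve, edge classes, quartic normals of rims -/

/-- The parameter of vertex `v` on the moment curve: `v` itself. [new] -/
def tpar (v : Fin m) : ℝ := ((v : ℕ) : ℝ)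

/-- `tpar` is injective. [folklore] -/
theorem tpar_injective : Function.Injective (tpar (m := m)) := by
  intro v w h
  simp only [tpar, Nat.cast_inj] at h
  exact Fin.ext h

/-- The moment vector of vertex `v`. [new] -/
def Uvec (v : Fin m) : Fin 5 → ℝ := momentVec (tpar v)

/-- Coordinates of moment vectors are non-negative. [folklore] -/
theorem Uvec_nonneg (v : Fin m) (i : Fin 5) : 0 ≤ Uvec v i := by
  have ht : 0 ≤ tpar v := Nat.cast_nonneg _
  simp only [Uvec, momentVec]
  fin_cases i <;> simp <;> positivity

/-- Membership in `edgeVerts`. [folklore] -/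
theorem mem_edgeVerts_iff {e : Edge m} {v : Fin m} : v ∈ edgeVerts e ↔ v ∈ (e : Sym2 (Fin m)) := by
  simp [edgeVerts]

/-- The vertex set of the edge `s(a,b)`. [folklore] -/
theorem edgeVerts_mk {a b : Fin m} (hab : a ≠ b) :
    edgeVerts (⟨s(a, b), by simpa using hab⟩ : Edge m) = {a, b} := by
  ext v
  simp [edgeVerts]

/-- Every edge is `s(a,b)` for its two (distinct) vertices, with `edgeVerts = {a,b}`. [folklore] -/
theorem exists_edgeVerts_eq_pair (e : Edge m) : ∃ a b : Fin m, a ≠ b ∧ edgeVerts e = {a, b} :=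
  Finset.card_eq_two.1 (card_edgeVerts e)

/-- The class of an edge relative to `S`: the number of its endpoints in `S` (`2` core, `1` spoke, `0` rim). [new] -/
def cls (S : Finset (Fin m)) (e : Edge m) : ℕ := (edgeVerts e ∩ S).card

/-- `cls ≤ 2`. [folklore] -/
theorem cls_le_two (S : Finset (Fin m)) (e : Edge m) : cls S e ≤ 2 := by
  rw [cls, ← card_edgeVerts e]; exact card_le_card inter_subset_left

/-- The SPOKE VECTOR of an edge: the sum of the moment vectors of its endpoints outside `S` (for a spoke `{s,v}`: `U v`). [new] -/
def spokeVec (S : Finset (Fin m)) (e : Edge m) : Fin 5 → ℝ := ∑ v ∈ edgeVerts e \ S, Uvec v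

/-- Coordinates of spoke vectors are non-negative. [folklore] -/
theorem spokeVec_nonneg (S : Finset (Fin m)) (e : Edge m) (i : Fin 5) : 0 ≤ spokeVec S e i := by
  simp only [spokeVec, Finset.sum_apply]
  exact Finset.sum_nonneg fun v _ => Uvec_nonneg v i

/-- The quartic normal from the elementary symmetric functions `s = x + y`, `p = xy` of the pair. [new] -/
def quarticVec' (s p : ℝ) : Fin 5 → ℝ := ![1 - p ^ 2, 2 * p * s, -(s ^ 2 + 2 * p), 2 * s, -1]

/-- `quarticVec x y = quarticVec' (x+y) (xy)`. [folklore] -/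
theorem quarticVec_eq_quarticVec' (x y : ℝ) : quarticVec x y = quarticVec' (x + y) (x * y) := by
  simp only [quarticVec, quarticVec']
  congr 1
  · ring
  · congr 1
    · ring
    · congr 1
      ring

/-- The (unnormalised) quartic normal of an edge. [new] -/
def edgeN (e : Edge m) : Fin 5 → ℝ := quarticVec' (∑ v ∈ edgeVerts e, tpar v) (∏ v ∈ edgeVerts e, tpar v)

/-- For `e = {a,b}`: `edgeN e = quarticVec (tpar a) (tpar b)`. [new] -/
theorem edgeN_eq_quarticVec {e : Edge m} {a b : Fin m} (hab : a ≠ b) (he : edgeVerts e = {a, b}) :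
    edgeN e = quarticVec (tpar a) (tpar b) := by
  rw [edgeN, he, sum_pair hab, prod_pair hab, quarticVec_eq_quarticVec']

/-- `⟨edgeN e, edgeN e⟩ ≥ 1`. [folklore] -/
theorem one_le_edgeN_dotProduct_self (e : Edge m) : 1 ≤ edgeN e ⬝ᵥ edgeN e := by
  obtain ⟨a, b, hab, he⟩ := exists_edgeVerts_eq_pair e
  rw [edgeN_eq_quarticVec hab he]; exact one_le_quarticVec_dotProduct_self _ _

/-- The squared length `ν_e = ⟨N_e, N_e⟩` of the quartic normal. [new] -/
def nuE (e : Edge m) : ℝ := edgeN e ⬝ᵥ edgeN e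

/-- `ν_e ≥ 1`. [folklore] -/
theorem one_le_nuE (e : Edge m) : 1 ≤ nuE e := one_le_edgeN_dotProduct_self e

/-- The unit quartic normal of an edge. [new] -/
def nvec (e : Edge m) : Fin 5 → ℝ := unitOf (edgeN e)

/-- `nvec e` is a unit vector. [folklore] -/
theorem nvec_unit (e : Edge m) : nvec e ⬝ᵥ nvec e = 1 :=
  unitOf_dotProduct_self (lt_of_lt_of_le one_pos (one_le_nuE e))

/-- The height `η_e = 1/√ν_e` at which the normal of `e` sees its own endpoints. [new] -/
def etaE (e : Edge m) : ℝ := 1 / Real.sqrt (nuE e)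

/-- `1 ≤ √ν_e`. [folklore] -/
theorem one_le_sqrt_nuE (e : Edge m) : 1 ≤ Real.sqrt (nuE e) := by
  rw [← Real.sqrt_one]; exact Real.sqrt_le_sqrt (one_le_nuE e)

/-- `0 < η_e`. [folklore] -/
theorem etaE_pos (e : Edge m) : 0 < etaE e := by
  rw [etaE]; exact div_pos one_pos (lt_of_lt_of_le one_pos (one_le_sqrt_nuE e))

/-- `η_e ≤ 1`. [folklore] -/
theorem etaE_le_one (e : Edge m) : etaE e ≤ 1 := by
  rw [etaE, div_le_one (lt_of_lt_of_le one_pos (one_le_sqrt_nuE e))]; exact one_le_sqrt_nuE e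

/-- `⟨w, nvec e⟩ = ⟨w, N_e⟩ · η_e`. [folklore] -/
theorem dotProduct_nvec (w : Fin 5 → ℝ) (e : Edge m) : w ⬝ᵥ nvec e = (w ⬝ᵥ edgeN e) * etaE e := by
  rw [nvec, dotProduct_unitOf, etaE, nuE]; ring

/-- **The normal of a rim sees its endpoints at height `η_e`**: `⟨U a, nvec e⟩ = η_e` for `a ∈ e`. [new] -/
theorem Uvec_dotProduct_nvec_of_mem {e : Edge m} {a : Fin m} (ha : a ∈ edgeVerts e) : Uvec a ⬝ᵥ nvec e = etaE e := by
  obtain ⟨x, y, hxy, he⟩ := exists_edgeVerts_eq_pair e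
  rw [dotProduct_nvec, edgeN_eq_quarticVec hxy he, dotProduct_comm, Uvec]
  rw [he, mem_insert, mem_singleton] at ha
  rcases ha with rfl | rfl
  · rw [quarticVec_dotProduct_momentVec_left, one_mul]
  · rw [quarticVec_dotProduct_momentVec_right, one_mul]

/-- **… and every other vertex at height `≤ 0`**: `⟨U v, nvec e⟩ ≤ 0` for `v ∉ e`. [new] -/
theorem Uvec_dotProduct_nvec_of_not_mem {e : Edge m} {v : Fin m} (hv : v ∉ edgeVerts e) : Uvec v ⬝ᵥ nvec e ≤ 0 := by
  obtain ⟨x, y, hxy, he⟩ := exists_edgeVerts_eq_pair e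
  rw [dotProduct_nvec, edgeN_eq_quarticVec hxy he, dotProduct_comm, Uvec]
  rw [he, mem_insert, mem_singleton, not_or] at hv
  have h1 : (v : ℕ) ≠ (x : ℕ) := fun h => hv.1 (Fin.ext h)
  have h2 : (v : ℕ) ≠ (y : ℕ) := fun h => hv.2 (Fin.ext h)
  have h := quarticVec_dotProduct_momentVec_natCast_nonpos h1 h2
  exact mul_nonpos_of_nonpos_of_nonneg h (etaE_pos e).le

/-- Distinct edges have distinct unit normals. [new] -/
theorem nvec_injective : Function.Injective (nvec (m := m)) := by
  intro e e' h
  obtain ⟨a, b, hab, he⟩ := exists_edgeVerts_eq_pair e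
  obtain ⟨c, d, hcd, he'⟩ := exists_edgeVerts_eq_pair e'
  -- compare the last coordinates: `−η_e = −η_{e'}`, so `η_e = η_{e'}` and then `N_e = N_{e'}`
  have hlast : ∀ f : Edge m, nvec f 4 = -etaE f := by
    intro f
    obtain ⟨x, y, hxy, hf⟩ := exists_edgeVerts_eq_pair f
    simp only [nvec, unitOf, etaE, nuE, Pi.smul_apply, smul_eq_mul]
    rw [edgeN_eq_quarticVec hxy hf]
    simp [quarticVec]
  have hη : etaE e = etaE e' := by
    have := congrFun h 4; rw [hlast, hlast] at this; linarith
  have hN : edgeN e = edgeN e' := by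
    have hs : ∀ f : Edge m, edgeN f = (Real.sqrt (nuE f)) • nvec f := by
      intro f
      have hpos : 0 < Real.sqrt (nuE f) := lt_of_lt_of_le one_pos (one_le_sqrt_nuE f)
      rw [nvec, unitOf, smul_smul, ← nuE]
      field_simp
      simp
    have hsq : Real.sqrt (nuE e) = Real.sqrt (nuE e') := by
      have h1 := etaE_pos e
      rw [etaE] at hη h1
      rw [etaE] at hη
      have hpos : 0 < Real.sqrt (nuE e) := lt_of_lt_of_le one_pos (one_le_sqrt_nuE e)
      have hpos' : 0 < Real.sqrt (nuE e') := lt_of_lt_of_le one_pos (one_le_sqrt_nuE e')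
      field_simp at hη
      linarith
    rw [hs e, hs e', h, hsq]
  rw [edgeN_eq_quarticVec hab he, edgeN_eq_quarticVec hcd he'] at hN
  have hpos : 0 < tpar a + tpar b := by
    have ha : 0 ≤ tpar a := Nat.cast_nonneg _
    have hb : 0 ≤ tpar b := Nat.cast_nonneg _
    rcases ha.lt_or_eq with h0 | h0
    · linarith
    · -- `tpar a = 0`, then `tpar b ≠ 0`
      have : tpar b ≠ 0 := fun hb0 => hab (tpar_injective (h0.symm.trans hb0.symm))
      exact lt_of_le_of_ne (by linarith) (by rw [← h0]; simpa using this.symm)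
  obtain ⟨hs, hp⟩ := quarticVec_eq_quarticVec hpos hN
  apply edgeVerts_injective
  rw [he, he']
  rcases pair_eq_of_sum_eq_of_mul_eq hs hp with ⟨h1, h2⟩ | ⟨h1, h2⟩
  · rw [tpar_injective h1, tpar_injective h2]
  · rw [tpar_injective h1, tpar_injective h2, pair_comm]

/-! ## The constants of the construction -/

/-- `κ = 2 − 1/(2(k−2))`: the rim budget sits strictly between the best clique-free spoke load `2 − 1/(k−2)` and the clique's `2`. [new] -/
def kap (k : ℕ) : ℝ := 2 - 1 / (2 * ((k : ℝ) - 2))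

/-- The total spoke vector `V = Σ_{spokes} spokeVec/(k−2)` (dominates every graph's spoke vector coordinatewise). [new] -/
def Vtot (S : Finset (Fin m)) (k : ℕ) : Fin 5 → ℝ :=
  ∑ e ∈ (Finset.univ : Finset (Edge m)).filter (fun e => cls S e = 1), (1 / ((k : ℝ) - 2)) • spokeVec S e

/-- `A₂ = ⟨V, V⟩`. [new] -/
def A2 (S : Finset (Fin m)) (k : ℕ) : ℝ := Vtot S k ⬝ᵥ Vtot S k

/-- The base budget `A = (A₂ + 1)/2` (`A ≥ ½`, `A² ≥ A₂`, root-free). [new] -/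
def Abud (S : Finset (Fin m)) (k : ℕ) : ℝ := (A2 S k + 1) / 2

/-- The rim constant `c_e = κ η_e − A`. [new] -/
def cc (S : Finset (Fin m)) (k : ℕ) (e : Edge m) : ℝ := kap k * etaE e - Abud S k

/-- `C₁ = 2 + A ≥ |c_e|`. [new] -/
def C1 (S : Finset (Fin m)) (k : ℕ) : ℝ := 2 + Abud S k

/-- The number of edges of `K_m` (bounds every rim count). [new] -/
def Etot (m : ℕ) : ℝ := (Fintype.card (Edge m) : ℝ)

/-- The set of rims. [new] -/
def rims (S : Finset (Fin m)) : Finset (Edge m) := Finset.univ.filter fun e => cls S e = 0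

/-- Ordered pairs of distinct rims. [new] -/
def rimPairs (S : Finset (Fin m)) : Finset (Edge m × Edge m) := (rims S ×ˢ rims S).filter fun p => p.1 ≠ p.2

/-- The angular gap `θ₀ = min_{e ≠ e' rims} (1 − ⟨nvec e, nvec e'⟩)` (`1` if there are no two rims). [new] -/
def theta0 (S : Finset (Fin m)) : ℝ :=
  if h : (rimPairs S).Nonempty then (rimPairs S).inf' h (fun p => 1 - nvec p.1 ⬝ᵥ nvec p.2) else 1

/-- `ν_tot = Σ_e ν_e` (bounds every `ν_e`). [new] -/
def nutot (m : ℕ) : ℝ := ∑ e : Edge m, nuE e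

/-- The large scale `L`. [new] -/
def Lbig (S : Finset (Fin m)) (k : ℕ) : ℝ :=
  ((k : ℝ) - 2) * A2 S k * nutot m + 2 * Etot m * C1 S k / theta0 S + 1

/-- The core penalty `B`. [new] -/
def Bbig (S : Finset (Fin m)) (k : ℕ) : ℝ := Abud S k + Lbig S k * Etot m + Etot m * C1 S k + 1

/-- The set of core edges. [new] -/
def cores (S : Finset (Fin m)) : Finset (Edge m) := Finset.univ.filter fun e => cls S e = 2

/-- The base budget `a₀ = A + #core · B`. [new] -/
def a0 (S : Finset (Fin m)) (k : ℕ) : ℝ := Abud S k + (cores S).card * Bbig S k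

/-! ## The pencil: what adding an edge does to `(a; b)` -/

/-- Budget increment of an edge. [new] -/
def alphaP (S : Finset (Fin m)) (k : ℕ) (e : Edge m) : ℝ :=
  if cls S e = 2 then -Bbig S k else if cls S e = 1 then 0 else Lbig S k + cc S k e

/-- Vector increment of an edge. [new] -/
def betaP (S : Finset (Fin m)) (k : ℕ) (e : Edge m) : Fin 5 → ℝ :=
  if cls S e = 2 then 0 else if cls S e = 1 then (1 / ((k : ℝ) - 2)) • spokeVec S e else Lbig S k • nvec e

/-- The budget `a(u)` of a graph. [new] -/
def abud (S : Finset (Fin m)) (k : ℕ) (u : Edge m → Bool) : ℝ := a0 S k + ∑ e, if u e = true then alphaP S k e else 0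

/-- The vector `b(u)` of a graph. [new] -/
def bvec (S : Finset (Fin m)) (k : ℕ) (u : Edge m → Bool) : Fin 5 → ℝ := ∑ e, if u e = true then betaP S k e else 0

/-- Edges of `u` of class `j`. [new] -/
def onCls (S : Finset (Fin m)) (u : Edge m → Bool) (j : ℕ) : Finset (Edge m) :=
  Finset.univ.filter fun e => u e = true ∧ cls S e = j

/-- The spoke vector `w(u) = Σ_{spokes of u} spokeVec/(k−2)`. [new] -/
def wvec (S : Finset (Fin m)) (k : ℕ) (u : Edge m → Bool) : Fin 5 → ℝ :=
  ∑ e ∈ onCls S u 1, (1 / ((k : ℝ) - 2)) • spokeVec S e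

/-- The rim direction sum `Σ_{rims of u} nvec`. [new] -/
def nsum (S : Finset (Fin m)) (u : Edge m → Bool) : Fin 5 → ℝ := ∑ e ∈ onCls S u 0, nvec e

/-- Splitting a sum over the edges of `u` by class. [folklore] -/
theorem sum_ite_eq_sum_onCls {M : Type*} [AddCommMonoid M] (S : Finset (Fin m)) (u : Edge m → Bool) (f : Edge m → M) :
    (∑ e, if u e = true then f e else 0) = ∑ e ∈ onCls S u 2, f e + ∑ e ∈ onCls S u 1, f e + ∑ e ∈ onCls S u 0, f e := by
  classical
  rw [← Finset.sum_filter]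
  have hsplit : (Finset.univ.filter fun e : Edge m => u e = true) =
      onCls S u 2 ∪ (onCls S u 1 ∪ onCls S u 0) := by
    ext e
    simp only [mem_filter, mem_univ, true_and, onCls, mem_union]
    constructor
    · intro h
      have := cls_le_two S e
      interval_cases hc : cls S e <;> simp [h]
    · rintro (h | h | h) <;> exact h.1
  have hd1 : Disjoint (onCls S u 1) (onCls S u 0) := by
    rw [Finset.disjoint_left]; intro e h1 h0
    simp only [onCls, mem_filter] at h1 h0; omega
  have hd2 : Disjoint (onCls S u 2) (onCls S u 1 ∪ onCls S u 0) := by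
    rw [Finset.disjoint_left]; intro e h2 h
    simp only [onCls, mem_filter, mem_union] at h2 h; omega
  rw [hsplit, sum_union hd2, sum_union hd1, add_assoc]

/-- **The budget of a graph**: `a(u) = A + B·(#core − #core(u)) + L·#rims(u) + Σ_{rims(u)} c_e`. [new] -/
theorem abud_eq (S : Finset (Fin m)) (k : ℕ) (u : Edge m → Bool) :
    abud S k u = Abud S k + Bbig S k * ((cores S).card - (onCls S u 2).card) +
      Lbig S k * (onCls S u 0).card + ∑ e ∈ onCls S u 0, cc S k e := by
  rw [abud, sum_ite_eq_sum_onCls S u, a0]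
  have h2 : ∑ e ∈ onCls S u 2, alphaP S k e = -(Bbig S k) * (onCls S u 2).card := by
    rw [Finset.sum_congr rfl (g := fun _ => -Bbig S k), sum_const, nsmul_eq_mul, mul_comm]
    intro e he; simp only [onCls, mem_filter] at he; simp [alphaP, he.2]
  have h1 : ∑ e ∈ onCls S u 1, alphaP S k e = 0 := by
    refine Finset.sum_eq_zero fun e he => ?_
    simp only [onCls, mem_filter] at he; simp [alphaP, he.2]
  have h0 : ∑ e ∈ onCls S u 0, alphaP S k e = Lbig S k * (onCls S u 0).card + ∑ e ∈ onCls S u 0, cc S k e := by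
    rw [Finset.sum_congr rfl (g := fun e => Lbig S k + cc S k e), sum_add_distrib, sum_const, nsmul_eq_mul, mul_comm]
    intro e he; simp only [onCls, mem_filter] at he; simp [alphaP, he.2]
  rw [h2, h1, h0]; ring

/-- **The vector of a graph**: `b(u) = w(u) + L · Σ_{rims(u)} nvec`. [new] -/
theorem bvec_eq (S : Finset (Fin m)) (k : ℕ) (u : Edge m → Bool) :
    bvec S k u = wvec S k u + Lbig S k • nsum S u := by
  rw [bvec, sum_ite_eq_sum_onCls S u, wvec, nsum, Finset.smul_sum]
  have h2 : ∑ e ∈ onCls S u 2, betaP S k e = 0 := by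
    refine Finset.sum_eq_zero fun e he => ?_
    simp only [onCls, mem_filter] at he; simp [betaP, he.2]
  have h1 : ∑ e ∈ onCls S u 1, betaP S k e = ∑ e ∈ onCls S u 1, (1 / ((k : ℝ) - 2)) • spokeVec S e := by
    refine Finset.sum_congr rfl fun e he => ?_
    simp only [onCls, mem_filter] at he; simp [betaP, he.2]
  have h0 : ∑ e ∈ onCls S u 0, betaP S k e = ∑ e ∈ onCls S u 0, Lbig S k • nvec e := by
    refine Finset.sum_congr rfl fun e he => ?_
    simp only [onCls, mem_filter] at he; simp [betaP, he.2]
  rw [h2, h1, h0, zero_add]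

end SixPencil

/-- **Rim normals on the moment curve** (registered form): the unit quartic normal of an edge `e` sees the endpoints of `e`
at the height `η_e ∈ (0, 1]` and every other vertex at height `≤ 0`, and distinct edges have distinct normals. [new] -/
theorem six_pencil_normals : ∀ {m : ℕ} (e : Edge m), (0 < SixPencil.etaE e ∧ SixPencil.etaE e ≤ 1) ∧ (∀ a : Fin m, a ∈ edgeVerts e → SixPencil.Uvec a ⬝ᵥ SixPencil.nvec e = SixPencil.etaE e) ∧ (∀ v : Fin m, v ∉ edgeVerts e → SixPencil.Uvec v ⬝ᵥ SixPencil.nvec e ≤ 0) ∧ ∀ e' : Edge m, SixPencil.nvec e = SixPencil.nvec e' → e = e' :=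
  fun e => ⟨⟨SixPencil.etaE_pos e, SixPencil.etaE_le_one e⟩, fun _ ha => SixPencil.Uvec_dotProduct_nvec_of_mem ha,
    fun _ hv => SixPencil.Uvec_dotProduct_nvec_of_not_mem hv, fun _ h => SixPencil.nvec_injective h⟩

end

end Summit.PneNP.PneNP.Theorems
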